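import Literature.AnabelianGeometry.AbsoluteAnabelian.AbsTopIThm26iiProSigmaProofs
import Literature.AnabelianGeometry.AbsoluteAnabelian.AbsTopIThm26viProSigmaProofs
import Literature.AnabelianGeometry.AbsoluteAnabelian.AbsTopIThm26iProSigmaClausesProofs
import Literature.AnabelianGeometry.AbsoluteAnabelian.MLFGaloisElasticProofs
import Literature.AnabelianGeometry.AbsoluteAnabelian.MLFGaloisGroupsHolds
import Literature.AnabelianGeometry.AbsoluteAnabelian.AbsTopIThm214GroupPartHolds
import Literature.AnabelianGeometry.AbsoluteAnabelian.AbsTopIThm214GroupPartProofs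
import Literature.AnabelianGeometry.AbsoluteAnabelian.AbsTopIThm26Thm214RekeyedProofs
import Literature.AnabelianGeometry.AbsoluteAnabelian.AbsTopIProp23iGFGSurfaceModel
import HarnessLib

/-!
# [AbsTopI] §2 over a Δ that is only ALMOST pro-`Σ`: the bridge from the Def 2.1 (i) datum to the typed closers

S. Mochizuki, *Topics in Absolute Anabelian Geometry I: Generalities* (2012) [AbsTopI] (lit key
`paper:url-11ac98ba15fc`), Def 1.1 (iii) p. 10 ("almost pro-`Σ`": admits an open pro-`Σ` subgroup), Def 2.1 (i)
p. 17 ("`π₁(X_k̄) ↠ Δ_X` an ALMOST pro-`Σ`-maximal quotient … `Ker(Δ_X → Gal(Y/X))` is pro-`Σ`"), Thm 2.6 p. 21–22,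
Thm 2.14 p. 33.

CENSUS FINDING (abc-iut-w6-d071, L4 row «THM26-ALMOST-PROSIGMA»; L4-lead RULING #8i (1) q2 / 12:07Z): the tree's
PROOF-FILE closers of Thm 2.6 (i)/(ii)/(iv)/(v)/(vi) and Thm 2.14 take the construction datum as `IsProSet E.geom S`
("`Δ` is PRO-`Σ`"), whereas print's Def 2.1 (i) only makes `Δ` ALMOST pro-`Σ` (`IsAlmostPro E.geom S`, typed in
`AbsTopISemiAbsolute.lean`).  The pro-`Σ` hypothesis enters those closers through three mechanisms only, none of which
needs more than an OPEN pro-`Σ` subgroup.  This PROOF-ONLY file (no definition, no named fact) supplies the bridges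
and the re-keyed closers:

* (M1) `IsAlmostPro.apply_padicIntPi_eq_one` / `IsAlmostPro.apply_padicInt_eq_one` — `l ∉ Σ` ⇒ every continuous
  homomorphism from a compact almost pro-`Σ` group to `ℤ_lⁿ` is trivial (it kills an open normal pro-`Σ` subgroup,
  so its image is finite, and `ℤ_lⁿ` is torsion-free);
* (M2) `IsAlmostPro.isAlmostProOmissive_of_prime_not_mem` — a prime `q ∉ Σ ⊆ 𝔓𝔯𝔦𝔪𝔢𝔰` makes an almost pro-`Σ`
  group almost pro-omissive;
* (M3) `IsAlmostPro.subgroupOf_of_isOpen`, `FundamentalExtension.isAlmostPro_geom_inf_of_isOpen` — almost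
  pro-`Σ` passes to open subgroups (`Δ ∩ H` for `H ⊆ Π` open);
* `IsProSet.isAlmostPro` (pro-`Σ` ⇒ almost pro-`Σ`), `isProSet_of_isProSigma` (the [CombGC] predicate
  `IsProSigma` ⇒ the [AbsTopI] predicate `IsProSet` on a compact group) and `GFGSurfaceModel.isAlmostPro` — **the
  Def 2.1 (i) GFG construction `D = Δ_X` (abc-iut-w6-d030 p440186 / abc-iut-w6-d071 p443001) IS almost pro-`Σ`**
  (witness: the open subgroup `π(U) = U^Σ`);
* RE-KEYED CLOSERS over `IsAlmostPro E.geom S`: `freeProlRank_arith_eq_gal_of_isAlmostPro`,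
  `thm26ii_of_isAlmostPro_of_rank` (Thm 2.6 (ii)), `MLFBase.thm26iv_of_isAlmostPro`,
  `MLFBase.preservesGeom_of_isAlmostPro`, `MLFBase.thm214GroupPart_of_isAlmostPro` (Thm 2.6 (iv), Thm 2.14 (i) group
  part), `NFBase.thm26vi_of_isAlmostPro` (Thm 2.6 (vi)), `freeProlRank_eq_aug_map_of_isAlmostPro`,
  `freeProlRank_open_eq_one_of_isFreeProcyclic_of_isAlmostPro` (Thm 2.6 (i)/(ii) off-`Σ` clauses at open subgroups).

HONEST SCOPE / what is NOT re-keyed here: Thm 2.6 (iii) clause 1 (`thetaSet_two_subset_of_isProSet`), whose landed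
`ℤ/lⁱ`-vanishing route uses pro-`Σ`-ness of `Δ ∩ J` essentially (an almost pro-`Σ` `Δ ∩ J` only bounds the torsion);
and the general-`Θ` Thm 2.6 (v) closers, which thread `IsProSet` through `zetaTildeInv_eq_of_inputs` (re-keying them
is a mechanical copy using (M2)+(M3), left to a sequel).  Classical profinite group theory on top of landed files;
OUR kernel check; nothing here bears on [IUTchIII] Cor. 3.12; no side is taken.
-/

noncomputable section

open Topology

namespace Literature.AnabelianGeometry.AbsoluteAnabelian

universe u

/-! ### Generic bridges -/

section Generic

variable {G : Type u} [Group G] [TopologicalSpace G]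

/-- Pro-`Σ` ⇒ almost pro-`Σ` (witnessed on the open subgroup `⊤`). [cite: MochizukiAbsTopI2012, Def 1.1 (iii) p.10] -/
theorem IsProSet.isAlmostPro [IsTopologicalGroup G] {S : Set ℕ} (h : IsProSet G S) : IsAlmostPro G S := by
  have htop : IsOpen (((⊤ : Subgroup G)) : Set G) := by rw [Subgroup.coe_top]; exact isOpen_univ
  refine ⟨⟨⊤, htop, ?_⟩⟩
  let ι : G →ₜ* (⊤ : Subgroup G) :=
    ⟨(Subgroup.topEquiv : (⊤ : Subgroup G) ≃* G).symm.toMonoidHom, Continuous.subtype_mk continuous_id _⟩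
  exact h.of_surjective ι (Subgroup.topEquiv (G := G)).symm.surjective

/-- Almost pro-`Σ` is monotone in `Σ`. [cite: MochizukiAbsTopI2012, Def 1.1 (iii) p.10] -/
theorem IsAlmostPro.mono {S T : Set ℕ} (h : IsAlmostPro G S) (hST : S ⊆ T) : IsAlmostPro G T := by
  obtain ⟨H, hHo, hH⟩ := h.exists_open_pro
  exact ⟨⟨H, hHo, hH.mono hST⟩⟩

/-- **(M2)** An almost pro-`Σ` group with `Σ ⊆ 𝔓𝔯𝔦𝔪𝔢𝔰` omitting the prime `q` is almost pro-omissive (its open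
pro-`Σ` subgroup is pro-`(𝔓𝔯𝔦𝔪𝔢𝔰 ∖ {q})`). [cite: MochizukiAbsTopI2012, Def 1.1 (iii) p.10] -/
theorem IsAlmostPro.isAlmostProOmissive_of_prime_not_mem {S : Set ℕ} (h : IsAlmostPro G S)
    (hS : S ⊆ {q | q.Prime}) {q : ℕ} (hq : q.Prime) (hqS : q ∉ S) : IsAlmostProOmissive G := by
  obtain ⟨H, hHo, hH⟩ := h.exists_open_pro
  exact ⟨⟨q, H, hq, hHo, hH.mono fun r hr => ⟨hS hr, fun hrq => hqS (hrq ▸ hr)⟩⟩⟩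

variable [IsTopologicalGroup G] [CompactSpace G]

/-- **(M1)** A continuous homomorphism from a compact ALMOST pro-`Σ` group to `ℤ_lⁿ`, `l ∉ Σ`, is trivial: it kills
the normal core `N` of an open pro-`Σ` subgroup (`IsProSet.apply_padicIntPi_eq_one` on the open pro-`Σ` subgroup),
`N` has finite index `m`, so `ψ(x)^m = ψ(x^m) = 1`, and `ℤ_lⁿ` is torsion-free.  (Print, proof of Thm 2.6 (ii) p.23:
"`δ¹_l(Π) = δ¹_l(G)` for `l ∉ Σ`" — valid for the almost pro-`Σ` `Δ` of Def 2.1 (i).)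
[cite: MochizukiAbsTopI2012, Thm 2.6 (ii) p.21] -/
theorem IsAlmostPro.apply_padicIntPi_eq_one {S : Set ℕ} (h : IsAlmostPro G S) {l : ℕ} [hl : Fact l.Prime]
    (hlS : l ∉ S) {n : ℕ} (ψ : G →ₜ* Multiplicative (Fin n → ℤ_[l])) (x : G) : ψ x = 1 := by
  classical
  obtain ⟨H, hHo, hH⟩ := h.exists_open_pro
  -- `ψ` is trivial on `H`
  have hψH : ∀ y ∈ H, ψ y = 1 := by
    intro y hy
    let ψH : H →ₜ* Multiplicative (Fin n → ℤ_[l]) :=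
      ⟨ψ.toMonoidHom.comp H.subtype, ψ.continuous.comp continuous_subtype_val⟩
    exact hH.apply_padicIntPi_eq_one hlS ψH ⟨y, hy⟩
  -- the normal core of `H` has finite index `m`, and `x ^ m ∈ H`
  haveI : Finite (G ⧸ H) := Subgroup.quotient_finite_of_isOpen H hHo
  haveI : H.FiniteIndex := Subgroup.finiteIndex_of_finite_quotient
  set m : ℕ := H.normalCore.index with hm
  have hm0 : m ≠ 0 := Subgroup.FiniteIndex.index_ne_zero
  have hxm : x ^ m ∈ H := H.normalCore_le (Subgroup.pow_index_mem H.normalCore x)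
  have hpow : ψ x ^ m = 1 := by rw [← map_pow]; exact hψH _ hxm
  -- `ℤ_lⁿ` is torsion-free
  apply Multiplicative.toAdd.injective
  funext i
  have h2 : Multiplicative.toAdd (ψ x ^ m) = m • Multiplicative.toAdd (ψ x) := toAdd_pow _ _
  have h1 : (m : ℤ_[l]) * (Multiplicative.toAdd (ψ x) : Fin n → ℤ_[l]) i = 0 := by
    have h3 := congrFun h2 i
    rw [hpow, toAdd_one, Pi.zero_apply, Pi.smul_apply, nsmul_eq_mul] at h3
    exact h3.symm
  rcases mul_eq_zero.mp h1 with h1 | h1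
  · exact absurd h1 (Nat.cast_ne_zero.mpr hm0)
  · rw [h1]; rfl

/-- **(M1), rank one**: a continuous homomorphism from a compact almost pro-`Σ` group to `ℤ_l`, `l ∉ Σ`, is trivial.
[cite: MochizukiAbsTopI2012, Thm 2.6 (ii) p.21] -/
theorem IsAlmostPro.apply_padicInt_eq_one {S : Set ℕ} (h : IsAlmostPro G S) {l : ℕ} [Fact l.Prime]
    (hlS : l ∉ S) (ψ : G →ₜ* Multiplicative ℤ_[l]) (x : G) : ψ x = 1 := by
  let ι : Multiplicative ℤ_[l] →ₜ* Multiplicative (Fin 1 → ℤ_[l]) :=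
    { toFun := fun y => Multiplicative.ofAdd fun _ => Multiplicative.toAdd y
      map_one' := rfl
      map_mul' := fun _ _ => rfl
      continuous_toFun := continuous_ofAdd.comp (continuous_pi fun _ => continuous_toAdd) }
  have h1 := h.apply_padicIntPi_eq_one hlS (ι.comp ψ) x
  -- evaluate the (unique) coordinate
  have h0 : Multiplicative.toAdd (ι.comp ψ x) 0 = 0 := by
    rw [h1]; rfl
  exact Multiplicative.toAdd.injective h0

variable [TotallyDisconnectedSpace G]

/-- **(M3)** Almost pro-`Σ` passes to open subgroups: if `H ⊆ G` is open pro-`Σ` and `V ⊆ G` is open, then `H ∩ V`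
is an open pro-`Σ` subgroup of `V` (an open subgroup of the pro-`Σ` profinite `H`, `IsProSet.subgroup_of_isOpen`).
[cite: MochizukiAbsTopI2012, Def 1.1 (iii) p.10] -/
theorem IsAlmostPro.subgroupOf_of_isOpen {S : Set ℕ} (h : IsAlmostPro G S) {V : Subgroup G}
    (hV : IsOpen (V : Set G)) : IsAlmostPro V S := by
  obtain ⟨H, hHo, hH⟩ := h.exists_open_pro
  haveI : CompactSpace H := isCompact_iff_compactSpace.mp (H.isClosed_of_isOpen hHo).isCompact
  -- `H ∩ V` inside `H`: open, hence pro-`Σ`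
  have hWHo : IsOpen (((H ⊓ V).subgroupOf H : Subgroup H) : Set H) := by
    have : (((H ⊓ V).subgroupOf H : Subgroup H) : Set H) = Subtype.val ⁻¹' (V : Set G) := by
      ext x
      simp only [SetLike.mem_coe, Subgroup.mem_subgroupOf, Subgroup.mem_inf, Set.mem_preimage]
      exact ⟨fun hx => hx.2, fun hx => ⟨x.2, hx⟩⟩
    rw [this]; exact hV.preimage continuous_subtype_val
  have hWH : IsProSet ((H ⊓ V).subgroupOf H) S := hH.subgroup_of_isOpen hWHo
  -- `H ∩ V` inside `V`: open
  have hWVo : IsOpen (((H ⊓ V).subgroupOf V : Subgroup V) : Set V) := by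
    have : (((H ⊓ V).subgroupOf V : Subgroup V) : Set V) = Subtype.val ⁻¹' (H : Set G) := by
      ext x
      simp only [SetLike.mem_coe, Subgroup.mem_subgroupOf, Subgroup.mem_inf, Set.mem_preimage]
      exact ⟨fun hx => hx.1, fun hx => ⟨hx, x.2⟩⟩
    rw [this]; exact hHo.preimage continuous_subtype_val
  -- transport along the evident bicontinuous isomorphism
  let f : ((H ⊓ V).subgroupOf H : Subgroup H) →ₜ* ((H ⊓ V).subgroupOf V : Subgroup V) :=
    { toFun := fun x => ⟨⟨(x : H), (Subgroup.mem_subgroupOf.mp x.2).2⟩, by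
        rw [Subgroup.mem_subgroupOf]; exact Subgroup.mem_subgroupOf.mp x.2⟩
      map_one' := rfl
      map_mul' := fun _ _ => rfl
      continuous_toFun := by
        refine Continuous.subtype_mk (Continuous.subtype_mk ?_ _) _
        exact continuous_subtype_val.comp continuous_subtype_val }
  have hf : Function.Surjective f := by
    rintro ⟨⟨y, hyV⟩, hy⟩
    have hy' := Subgroup.mem_subgroupOf.mp hy
    exact ⟨⟨⟨y, hy'.1⟩, by rw [Subgroup.mem_subgroupOf]; exact hy'⟩, rfl⟩
  exact ⟨⟨(H ⊓ V).subgroupOf V, hWVo, hWH.of_surjective f hf⟩⟩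

omit [TotallyDisconnectedSpace G] in
/-- The [CombGC]/[SemiAnbd] predicate `IsProSigma Σ G` implies the [AbsTopI] predicate `IsProSet G Σ` on a compact group
(an open normal subgroup has a finite quotient, whose order is its index). [cite: MochizukiAbsTopI2012, Def 1.1 (iii) p.10] -/
theorem isProSet_of_isProSigma {S : Set ℕ} (h : Literature.AnabelianGeometry.SemiGraphs.IsProSigma S G) :
    IsProSet G S := by
  refine ⟨fun U hUn hUo q hq hqd => ?_⟩
  haveI := hUn
  haveI : Finite (G ⧸ U) := Subgroup.quotient_finite_of_isOpen U hUo
  let U' : OpenNormalSubgroup G := { toSubgroup := U, isOpen' := hUo, isNormal' := hUn }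
  exact h.prime_mem U' (inferInstanceAs (Finite (G ⧸ U))) q hq (by rwa [← Subgroup.index_eq_card])

end Generic

/-! ### The Def 2.1 (i) GFG construction is almost pro-`Σ` -/

namespace GFGSurfaceModel

open Literature.AnabelianGeometry.SemiGraphs.PSCDatum (IsMaxProSigmaQuotient)

variable {Sigma : Set ℕ} {P : Type u} [Group P] [TopologicalSpace P] [IsTopologicalGroup P] [CompactSpace P]
  {D : Type u} [Group D] [TopologicalSpace D] [IsTopologicalGroup D] [CompactSpace D] [T2Space D]
  {π : P →* D} {U : Subgroup P}

/-- **The almost pro-`Σ`-maximal quotient `Δ_X = D` of [AbsTopI] Def 2.1 (i) IS almost pro-`Σ`** (Def 1.1 (iii)):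
its open subgroup `π(U) = Ker(Δ_X → Gal(Y/X)) = U^Σ` is pro-`Σ` (`hmax.proSigma`).  So the HONEST hypothesis for
the §2 closers at this construction is `IsAlmostPro`, not `IsProSet`. [cite: MochizukiAbsTopI2012, Def 2.1 (i) p.17] -/
theorem isAlmostPro (hUo : IsOpen (U : Set P)) (hπc : Continuous π) (hπs : Function.Surjective π)
    (hker : π.ker ≤ U) (hmax : IsMaxProSigmaQuotient Sigma (π.subgroupMap U)) : IsAlmostPro D Sigma := by
  haveI : CompactSpace (U.map π) :=
    isCompact_iff_compactSpace.mp (isClosed_map hUo hπc).isCompact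
  exact ⟨⟨U.map π, isOpen_map hUo hπc hπs hker, isProSet_of_isProSigma hmax.proSigma⟩⟩

end GFGSurfaceModel

/-! ### Re-keyed closers over `IsAlmostPro E.geom S` -/

namespace FundamentalExtension

variable (E : FundamentalExtension.{u})

/-- **(M3) for extensions**: for `Δ` almost pro-`Σ` and `H ⊆ Π` open, `Δ ∩ H` is almost pro-`Σ`.
[cite: MochizukiAbsTopI2012, Def 1.1 (iii) p.10] -/
theorem isAlmostPro_geom_inf_of_isOpen {S : Set ℕ} (hpro : IsAlmostPro E.geom S) (H : Subgroup E.arith)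
    (hH : IsOpen (H : Set E.arith)) : IsAlmostPro ↥(E.geom ⊓ H) S := by
  haveI : CompactSpace E.geom := isCompact_iff_compactSpace.mp E.isClosed_geom.isCompact
  let V : Subgroup E.geom := (E.geom ⊓ H).subgroupOf E.geom
  have hVo : IsOpen (V : Set E.geom) := by
    have hV : (V : Set E.geom) = Subtype.val ⁻¹' (H : Set E.arith) := by
      ext x
      simp only [V, SetLike.mem_coe, Subgroup.mem_subgroupOf, Subgroup.mem_inf, Set.mem_preimage]
      exact ⟨fun h => h.2, fun h => ⟨x.2, h⟩⟩
    rw [hV]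
    exact hH.preimage continuous_subtype_val
  have hV : IsAlmostPro V S := hpro.subgroupOf_of_isOpen hVo
  let e₀ : V ≃* ↥(E.geom ⊓ H) := Subgroup.subgroupOfEquivOfLe inf_le_left
  let e : V ≃ₜ* ↥(E.geom ⊓ H) :=
    { e₀ with
      continuous_toFun := by
        refine Continuous.subtype_mk ?_ _
        exact continuous_subtype_val.comp continuous_subtype_val
      continuous_invFun := by
        refine Continuous.subtype_mk (Continuous.subtype_mk continuous_subtype_val _) _ }
  exact hV.of_continuousMulEquiv e

/-- **Thm 2.6 (ii), clause "`δ¹_l(Π) = δ¹_l(G)` for `l ∉ Σ`", for `Δ` ALMOST pro-`Σ`** — every continuous surjection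
`Π ↠ ℤ_lⁿ` kills `Δ` by (M1), hence factors through `G`. [cite: MochizukiAbsTopI2012, Thm 2.6 (ii) p.21] -/
theorem freeProlRank_arith_eq_gal_of_isAlmostPro {S : Set ℕ} (hΔ : IsAlmostPro E.geom S) (l : ℕ)
    [Fact l.Prime] (hlS : l ∉ S) : freeProlRank E.arith l = freeProlRank E.gal l := by
  haveI : CompactSpace E.geom := isCompact_iff_compactSpace.mp E.isClosed_geom.isCompact
  refine le_antisymm ?_ (freeProlRank_le_of_surjective E.aug E.aug_surjective l)
  unfold freeProlRank
  refine iSup₂_le fun n hn => ?_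
  obtain ⟨f, hf⟩ := hn
  have hker : ∀ a, E.aug a = 1 → f a = 1 := by
    intro a ha
    let ψ : E.geom →ₜ* Multiplicative (Fin n → ℤ_[l]) :=
      ⟨f.toMonoidHom.comp E.geom.subtype, f.continuous.comp continuous_subtype_val⟩
    exact hΔ.apply_padicIntPi_eq_one hlS ψ ⟨a, (E.mem_geom).mpr ha⟩
  obtain ⟨χ, hχ⟩ := exists_continuousMonoidHom_factor E.aug E.aug_surjective f hker
  have hχs : Function.Surjective χ := fun y => by
    obtain ⟨a, ha⟩ := hf y
    exact ⟨E.aug a, by rw [hχ, ha]⟩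
  exact le_iSup₂_of_le n ⟨χ, hχs⟩ le_rfl

/-- **Thm 2.6 (i)/(ii) off-`Σ` clause at every open `H ⊆ Π`, for `Δ` ALMOST pro-`Σ`**: "`δ¹_l(H) = δ¹_l(G_H)` for
`l ∉ Σ`" — every continuous character `Δ ∩ H → ℤ_l` is trivial by (M1)+(M3), so abc-iut-L4-t4's
`freeProlRank_eq_aug_map_of_invariantCharacters_trivial` applies. [cite: MochizukiAbsTopI2012, Thm 2.6 (ii) p.21] -/
theorem freeProlRank_eq_aug_map_of_isAlmostPro (S : Set ℕ) (hpro : IsAlmostPro E.geom S)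
    (H : Subgroup E.arith) (hH : IsOpen (H : Set E.arith)) (l : ℕ) [Fact l.Prime] (hl : l ∉ S) :
    freeProlRank H l = freeProlRank (H.map E.aug.toMonoidHom) l := by
  haveI : CompactSpace ↥(E.geom ⊓ H) :=
    isCompact_iff_compactSpace.mp (E.isClosed_geom.inter (H.isClosed_of_isOpen hH)).isCompact
  exact E.freeProlRank_eq_aug_map_of_invariantCharacters_trivial H hH l
    fun ψ _ d => (E.isAlmostPro_geom_inf_of_isOpen hpro H hH).apply_padicInt_eq_one hl ψ d

/-- **Thm 2.6 (i) "`δ¹_l(H) = 1` for `l ∉ Σ`", every open `H ⊆ Π`, for `G ≅ Ẑ` and `Δ` ALMOST pro-`Σ`.**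
[cite: MochizukiAbsTopI2012, Thm 2.6 (i) p.21] -/
theorem freeProlRank_open_eq_one_of_isFreeProcyclic_of_isAlmostPro (hG : IsFreeProcyclic E.gal)
    (S : Set ℕ) (hpro : IsAlmostPro E.geom S) (H : Subgroup E.arith) (hH : IsOpen (H : Set E.arith))
    (l : ℕ) [Fact l.Prime] (hl : l ∉ S) : freeProlRank H l = 1 := by
  haveI : CompactSpace ↥(E.geom ⊓ H) :=
    isCompact_iff_compactSpace.mp (E.isClosed_geom.inter (H.isClosed_of_isOpen hH)).isCompact
  exact E.freeProlRank_open_eq_one_of_isFreeProcyclic hG H hH l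
    fun ψ _ d => (E.isAlmostPro_geom_inf_of_isOpen hpro H hH).apply_padicInt_eq_one hl ψ d

variable {E}

/-- `δ¹_l(G) < ∞` for MLF base data (LCFT ranks, `freeProlRank_gal`). [cite: MochizukiAbsTopI2012, Thm 2.6 (ii) p.21] -/
private theorem freeProlRank_gal_ne_top'' {E : FundamentalExtension.{0}} (B : E.MLFBase) (l : ℕ)
    [Fact l.Prime] : freeProlRank E.gal l ≠ ⊤ := by
  by_cases hl : l = B.p
  · subst hl
    rw [(freeProlRank_gal B).2]
    exact ENat.coe_ne_top _
  · rw [(freeProlRank_gal B).1 l hl]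
    exact ENat.one_ne_top

/-- **[AbsTopI] Thm 2.6 (ii) AS TYPED for `Δ` ALMOST pro-`Σ`** (MLF base data; `Π` tfg; the printed rank identity for
`l ∈ Σ` as the hypothesis `hQ`, exactly as in `thm26ii_of_isProSet_of_rank`).
[cite: MochizukiAbsTopI2012, Thm 2.6 (ii) p.21] -/
theorem thm26ii_of_isAlmostPro_of_rank {E : FundamentalExtension.{0}} (B : E.MLFBase) (S : Set ℕ)
    (htfg : IsTopologicallyFinitelyGenerated E.arith) (hpro : IsAlmostPro E.geom S)
    (hQ : ∃ m : ℕ, ∀ (l : ℕ) [Fact l.Prime], l ∈ S →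
      freeProlRank E.arith l = freeProlRank E.gal l + m) :
    E.Thm26ii B S := by
  refine thm26ii_of_clauses B S htfg ?_ ?_
  · intro l _ hlS
    exact E.freeProlRank_arith_eq_gal_of_isAlmostPro hpro l hlS
  · intro l₁ l₂ _ _ h₁ h₂
    obtain ⟨m, hm⟩ := hQ
    rw [hm l₁ h₁, hm l₂ h₂,
      (ENat.addLECancellable_of_ne_top (freeProlRank_gal_ne_top'' B l₁)).add_tsub_cancel_left,
      (ENat.addLECancellable_of_ne_top (freeProlRank_gal_ne_top'' B l₂)).add_tsub_cancel_left]

/-- **[AbsTopI] Thm 2.6 (iv) AS TYPED for `Δ` ALMOST pro-`Σ`** (`Σ ⊆ 𝔓𝔯𝔦𝔪𝔢𝔰`; `Δ` tfg by Prop 2.2): clause 1 by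
elasticity of `G_k` (`le_geom_of_isAlmostProOmissive_of_isElastic_gal`, `MLFBase.isElastic_gal`), clause 2 by (M2).
[cite: MochizukiAbsTopI2012, Thm 2.6 (iv) p.22] -/
theorem MLFBase.thm26iv_of_isAlmostPro {E : FundamentalExtension.{0}} (B : E.MLFBase) (hΔ : E.GeomTFG)
    {S : Set ℕ} (hS : S ⊆ {q | q.Prime}) (hΔS : IsAlmostPro E.geom S) : E.Thm26iv S := by
  refine ⟨fun N hN hNc hNfg hNapo =>
    le_geom_of_isAlmostProOmissive_of_isElastic_gal B B.isElastic_gal N hN hNc hNfg hNapo,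
    fun hne => ⟨?_, hΔ⟩⟩
  obtain ⟨q, hq, hqS⟩ : ∃ q, q.Prime ∧ q ∉ S := by
    by_contra hall
    push Not at hall
    exact hne (Set.Subset.antisymm hS fun q hq => hall q hq)
  exact hΔS.isAlmostProOmissive_of_prime_not_mem hS hq hqS

/-- **"`Δ ⊆ Π` is group-theoretic" (Thm 2.6 (iv), `Σ ≠ 𝔓𝔯𝔦𝔪𝔢𝔰`) for ALMOST pro-`Σ` geometric groups**: every
`φ : Π_E ⥲ Π_F` carries `Δ_E` onto `Δ_F`. [cite: MochizukiAbsTopI2012, Thm 2.6 (iv) p.22] -/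
theorem MLFBase.preservesGeom_of_isAlmostPro {E F : FundamentalExtension.{0}} (BE : E.MLFBase) (BF : F.MLFBase)
    (hΔE : E.GeomTFG) (hΔF : F.GeomTFG) {S T : Set ℕ} (hS : S ⊆ {q | q.Prime})
    (hS' : S ≠ {q | q.Prime}) (hES : IsAlmostPro E.geom S) (hT : T ⊆ {q | q.Prime})
    (hT' : T ≠ {q | q.Prime}) (hFT : IsAlmostPro F.geom T) (φ : E.arith ≃ₜ* F.arith) :
    PreservesGeom φ :=
  preservesGeom_of_thm26iv (MLFBase.thm26iv_of_isAlmostPro BE hΔE hS hES) hS'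
    (MLFBase.thm26iv_of_isAlmostPro BF hΔF hT hFT) hT' φ

/-- **[AbsTopI] Thm 2.14 (i), group part, for ALMOST pro-`Σᵢ` geometric groups** (`Σᵢ ⊊ 𝔓𝔯𝔦𝔪𝔢𝔰`).
[cite: MochizukiAbsTopI2012, Thm 2.14 (i) p.33] -/
theorem MLFBase.thm214GroupPart_of_isAlmostPro {E F : FundamentalExtension.{0}} (B₁ : E.MLFBase)
    (B₂ : F.MLFBase) (hΔ₁ : E.GeomTFG) (hΔ₂ : F.GeomTFG) {S T : Set ℕ} (hS : S ⊆ {q | q.Prime})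
    (hS' : S ≠ {q | q.Prime}) (hES : IsAlmostPro E.geom S) (hT : T ⊆ {q | q.Prime})
    (hT' : T ≠ {q | q.Prime}) (hFT : IsAlmostPro F.geom T) (φ : E.arith ≃ₜ* F.arith) :
    Thm214GroupPart B₁ B₂ φ :=
  (MLFBase.preservesGeom_of_isAlmostPro B₁ B₂ hΔ₁ hΔ₂ hS hS' hES hT hT' hFT φ).thm214GroupPart B₁ B₂

/-- **[AbsTopI] Thm 2.6 (vi) AS TYPED for `Δ` ALMOST pro-`Σ`** (NF base data; `Δ` tfg; the Tate-module input for the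
primes `l ∈ Σ` only — for `l ∉ Σ` every continuous `Δ → ℤ_l` is trivial by (M1)).
[cite: MochizukiAbsTopI2012, Thm 2.6 (vi) p.22] -/
theorem NFBase.thm26vi_of_isAlmostPro {E : FundamentalExtension.{0}} (B : E.NFBase) (S : Set ℕ)
    (hpro : IsAlmostPro E.geom S) (hΔ : E.GeomTFG)
    (hT : ∀ (l : ℕ) [Fact l.Prime], l ∈ S → ∀ (ψ : E.geom →ₜ* Multiplicative ℤ_[l]),
      (∀ (g : E.arith) (d d' : E.geom), (d' : E.arith) = g * d * g⁻¹ → ψ d' = ψ d) →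
        ∀ d, ψ d = 1) :
    E.Thm26vi := by
  haveI : CompactSpace E.geom := isCompact_iff_compactSpace.mp E.isClosed_geom.isCompact
  refine NFBase.thm26vi_of_invariantCharacters_trivial B hΔ fun l _ ψ hψ d => ?_
  by_cases hl : l ∈ S
  · exact hT l hl ψ hψ d
  · exact hpro.apply_padicInt_eq_one hl ψ d

end FundamentalExtension

end Literature.AnabelianGeometry.AbsoluteAnabelian

end
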